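import Summits.QuantumFields.YangMills.Theses.ConvexGribovBody
import Summits.QuantumFields.YangMills.Theorems.ConvexGribovBodyBrascampLiebVacuumStubRpHankel
import Literature.MathematicalPhysics.QuantumFieldTheory.LatticeGaugeProofs

/-!
# Stub `stub_transport` of the crux `BrascampLiebVacuum` (line `SketchIdeator2`): the transport identity and the one-step kick lemmas

The registered stub of the skeleton v7 proved here is `stub_transport` — the TRANSPORT IDENTITY
`f (τ₁ U) = f (P • U₀)` for gauge-invariant `f` depending only on the time-zero spatial links (it is
`oneStep_transport` with all binders explicit, in exactly the registered shape). Every other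
declaration of this file is a RIDER: the kernel-checked first steps, and the complete LOSSY chain
`c(f) = E_μ (f - f ∘ τ₁)² ≤ 6 K² (2S+1)⁶ · plaq`, toward the ultraviolet one-step bound
(C) `c(f) ≤ C_C · plaq · dir f` of the WITHDRAWN v6 split (the obstruction recorded at the end of this
docstring is why that split was withdrawn):

* `oneStep_gaugeTransform_shift`: for EVERY configuration `U` of the torus and `h x := U (x, 0)`,
  `(τ₁ U)^h (x, j) = U_{p_{0j}(x)} · U (x, j)` on every edge `(x, j)`, where `U_{p_{0j}(x)} =
  plaquetteHolonomy U x 0 j = U(x,0) U(x+e₀,j) U(x+e_j,0)⁻¹ U(x,j)⁻¹` and `τ₁ U (x, j) = U (x + e₀, j)`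
  (no parity/size hypothesis); hence `oneStep_transport` (= `stub_transport`), with
  `(P • U₀)(x, j) = U_{p_{0j}(x)} · U(x, j)` on the slice `x₀ = 0`, `j ≠ 0`.
* `fro_mul_of_mem_unitaryGroup`, `fro_sub_one_eq`: unitary invariance of the crux's raw Frobenius
  form `fro M = Σ_{ab} |M_ab|²`, and `fro (W - 1) = 2N - 2 Re tr W` for unitary `W`.
* `oneStep_kick_sum`, `oneStep_sq_le`, `oneStep_le_lipschitz`: for link-Lipschitz `f` (constant `K`)
  `(f U - f (τ₁ U))² ≤ K² (Σ_{e ∈ slice} √fro (ρ P_e - 1))²`, pointwise and integrated.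
* `integral_plaquette_eq_origin`, `integral_fro_kick`: translation invariance of one-plaquette
  expectations and the MEAN-SQUARE KICK SIZE `E_μ ‖ρ P_{(x,j)} - 1‖_F² = 2 E_μ (N - Re tr ρ U_{p_{0j}(0)})`.
* `sum_slice_eq`, `sum_site_slice`, `sum_edge_slice`, `oneStep_kick_sq_le`, `integral_kick_sq_le_plaq`:
  slice bookkeeping (`L³` sites, `3L³` links) and Cauchy–Schwarz, `E_μ (Σ_{e ∈ slice} ‖ρ P_e - 1‖_F)²
  ≤ 6 L⁶ · plaq`; `oneStep_le_lipschitz_plaq`: `c(f) ≤ 6 K² (2S+1)⁶ · plaq` in the skeleton's `let`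
  conventions. (C) asserts `C_C · plaq · dir f` instead; the two losses are exactly (i) coherence —
  Cauchy–Schwarz over the `3(2S+1)³` slice links, where (C) needs the kicks seen through `∇f` to add
  incoherently — and (ii) the sup-type constant `K²` in place of the mean-square metric slope `dir f`.

All declarations are sorry-free and use only `propext`, `Classical.choice`, `Quot.sound`.

## Obstruction to (C) AS STATED (physics level; found while attempting the stub, NOT formalised)

For `G = SU(N)`, `N ≥ 5`, `r` fundamental, the centre element `z = e^{2πi/N}·1` is a strict local
MAXIMUM of `Re tr` on `SU(N)`: `Re tr (z e^{iX}) = N cos φ - (cos φ / 2) tr X² + O(X³)`, `φ = 2π/N`,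
`cos φ > 0` (for `N ≤ 4` there is no such centre trap). Put `u = N (1 - cos φ)` and let
`f = φ_ε(U_p)` be a smooth class function of ONE time-zero spatial plaquette holonomy, `= 1` where
`d(U_p, z) < ε₁`, `= 0` where `d(U_p, z) > ε₂` (gauge invariant, `t = 0`-local, link-Lipschitz).
Semiclassically (energy counting at large `β`, dilute lattice artefacts, any large volume):
* `Var f ≈ p := ν(d(U_p, z) < ε₁) ≈ e^{-6uβ}` — the single-link centre defect (4 slice + 2 temporal
  plaquettes of action `u`; minimal by flux conservation: 4 faces around a slice link, 6 in 4d);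
* `c(f) = E_μ (f - f ∘ τ₁)² ≈ 2p` — keeping the defect one more time step costs `4uβ` more
  (`10u` versus `6u`), so the transfer step removes it with probability `1 - O(e^{-4uβ})`: the kick
  `P_e = z⁻¹` of `oneStep_transport` IS the defect;
* `dir f ≤ 4 ‖∇φ_ε‖²_∞ · ν(ε₁ < d(U_p, z) < ε₂) ≈ p · e^{-3 cos φ · ε₁² β} / (ε₂ - ε₁)²` (the rim of
  the basin: defect with link value `z e^{iW}`, `‖W‖ ≥ ε₁`, costs `6 (u + cos φ ‖W‖²/2)`), and
  `0 ≤ plaq ≤ 6N` trivially.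
Hence `c(f) / (plaq · dir f) ≳ (ε₂ - ε₁)² e^{3 cos φ ε₁² β} / (12 N)` → ∞: no β-uniform `C_C` exists and
(C) is false for such `(G, r)` (the stub quantifies over all compact simple `G` and all `r`).
Mechanism: Wilson's BOUNDED one-step kinetic cost (`N - Re tr ≤ 2N` per temporal plaquette) lets the
transfer matrix leave in one step, at cost `u`, a basin which the slice law `ν` — whose effective
action `4·(slice plaquettes) + 2·(half-space relaxation R)`, `R(defect g) = N - Re tr g` near `z`,
inherits the strict local minimum — can only leave continuously through an exponentially rarer rim
(in continuum Euclidean time `R` would be a Jacobi distance without spurious minima and (C) would be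
the Kogut–Susskind ground-state identity). The crux survives this trap only through `Dmax` (soft spot
F3 of `Cruxes/BrascampLiebVacuum/Disproof.lean`); `plaq` cannot absorb it, and neither can any split
`c · b ≤ …` whose `c`-factor has a bounded right side. A RIGOROUS refutation needs the missing
volume-uniform weak-coupling control (here: `G(1) ≤ (1 - δ) G(0)` for the defect observable and the
`e^{-6uβ}` asymptotics of `p`), so none is attempted in Lean.
-/

open scoped BigOperators Topology Matrix
open Filter MeasureTheory Literature.MathematicalPhysics.QuantumFieldTheory

noncomputable section

namespace Summit.QuantumFields.YangMills.Theorems.BrascampLiebVacuum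

/-! ### The gauge-transport algebra and the registered stub -/

/-- **One Euclidean time step is a gauge transform of a field of temporal-plaquette kicks**: for every
`U` and `h x := U (x, 0)`, `gaugeTransform h (τ₁ U) (x, j) = plaquetteHolonomy U x 0 j * U (x, j)`. [folklore] -/
theorem oneStep_gaugeTransform_shift {L : ℕ} {G : Type*} [Group G] (U : GaugeConfig 4 L G) :
    gaugeTransform (fun x => U (x, 0)) (fun e => U (e.1 + Pi.single 0 1, e.2)) =
      fun e => plaquetteHolonomy U e.1 0 e.2 * U e := by
  funext e
  simp only [gaugeTransform, plaquetteHolonomy, Site.shift, Prod.mk.eta, inv_mul_cancel_right]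

/-- **Transport identity** `f ∘ τ₁ = f (P • U₀)` (gauge transformation `h x := U (x, 0)`, then
locality), with the tree's conventions verbatim; `stub_transport` is this with explicit binders. [folklore] -/
theorem oneStep_transport {G : Type} [Group G] {S : ℕ}
    (f : GaugeConfig 4 (2 * S + 1) G → ℝ) (hf₁ : IsGaugeInvariant f)
    (hf₂ : ∀ U V : GaugeConfig 4 (2 * S + 1) G,
      (∀ e : Edge 4 (2 * S + 1), e.1 0 = 0 → e.2 ≠ 0 → U e = V e) → f U = f V)
    (U : GaugeConfig 4 (2 * S + 1) G) :
    f (fun e => U (e.1 + Pi.single 0 ((1 : ℕ) : ZMod (2 * S + 1)), e.2)) =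
      f (fun e => if e.1 0 = 0 ∧ e.2 ≠ 0 then plaquetteHolonomy U e.1 0 e.2 * U e else U e) := by
  rw [Nat.cast_one, ← hf₁ (fun x => U (x, 0)), oneStep_gaugeTransform_shift]
  exact hf₂ _ _ fun e he0 hne => by rw [if_pos ⟨he0, hne⟩]

/-- **Stub (ALGEBRA, proved — transport identity `f ∘ τ₁ = f (P • U₀)`).** For a gauge-invariant `f`
depending only on the time-zero spatial links, translating by one unit of Euclidean time is the same
as multiplying every time-zero spatial link `U(x,j)` (`x₀ = 0`, `j ≠ 0`) on the left by the temporal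
plaquette `plaquetteHolonomy U x 0 j = U(x,0) U(x+e₀,j) U(x+e_j,0)⁻¹ U(x,j)⁻¹` through it: apply the
gauge transformation `h x := U (x, 0)` to `τ₁ U`, then locality. Every torus `(2S+1)⁴`, `S ≥ 0`. [folklore] -/
theorem stub_transport :
    ∀ (G : Type) [Group G] (S : ℕ) (f : GaugeConfig 4 (2 * S + 1) G → ℝ), IsGaugeInvariant f →
      (∀ U V : GaugeConfig 4 (2 * S + 1) G,
        (∀ e : Edge 4 (2 * S + 1), e.1 0 = 0 → e.2 ≠ 0 → U e = V e) → f U = f V) →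
      ∀ U : GaugeConfig 4 (2 * S + 1) G,
        f (fun e => U (e.1 + Pi.single 0 ((1 : ℕ) : ZMod (2 * S + 1)), e.2)) =
          f (fun e => if e.1 0 = 0 ∧ e.2 ≠ 0 then plaquetteHolonomy U e.1 0 e.2 * U e else U e) :=
  fun _ _ _ f hf₁ hf₂ U => oneStep_transport f hf₁ hf₂ U

/-- The crux's Frobenius form is a real part of a trace: `Σ_{ab} |M_ab|² = Re tr (M Mᴴ)`. [folklore] -/
theorem fro_eq_re_trace {N : ℕ} (M : Matrix (Fin N) (Fin N) ℂ) :
    ∑ a, ∑ b, ‖M a b‖ ^ 2 = (M * Mᴴ).trace.re := by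
  simp only [Matrix.trace, Matrix.diag, Matrix.mul_apply, Matrix.conjTranspose_apply,
    Complex.star_def, Complex.mul_conj, Complex.re_sum, Complex.ofReal_re, Complex.normSq_eq_norm_sq]

/-- Right unitary invariance of the crux's Frobenius form: `fro (M u) = fro M` for unitary `u`. [folklore] -/
theorem fro_mul_of_mem_unitaryGroup {N : ℕ} (M : Matrix (Fin N) (Fin N) ℂ)
    {u : Matrix (Fin N) (Fin N) ℂ} (hu : u ∈ Matrix.unitaryGroup (Fin N) ℂ) :
    ∑ a, ∑ b, ‖(M * u) a b‖ ^ 2 = ∑ a, ∑ b, ‖M a b‖ ^ 2 := by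
  have hu' : u * uᴴ = 1 := by
    rw [← Matrix.star_eq_conjTranspose]; exact Matrix.mem_unitaryGroup_iff.1 hu
  rw [fro_eq_re_trace, fro_eq_re_trace, Matrix.conjTranspose_mul, Matrix.mul_assoc,
    ← Matrix.mul_assoc u, hu', Matrix.one_mul]

/-- For unitary `W`: `fro (W - 1) = 2N - 2 Re tr W`, twice the Wilson plaquette action density when
`W = ρ(U_p)`. [folklore] -/
theorem fro_sub_one_eq {N : ℕ} {W : Matrix (Fin N) (Fin N) ℂ}
    (hW : W ∈ Matrix.unitaryGroup (Fin N) ℂ) :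
    ∑ a, ∑ b, ‖(W - 1) a b‖ ^ 2 = 2 * N - 2 * W.trace.re := by
  have hW' : W * Wᴴ = 1 := by
    rw [← Matrix.star_eq_conjTranspose]; exact Matrix.mem_unitaryGroup_iff.1 hW
  have e : (W - 1) * (W - 1)ᴴ = (1 - W) + (1 - Wᴴ) := by
    rw [Matrix.conjTranspose_sub, Matrix.conjTranspose_one, Matrix.sub_mul, Matrix.mul_sub,
      Matrix.mul_sub, hW', Matrix.one_mul, Matrix.mul_one, Matrix.one_mul]
    abel
  rw [fro_eq_re_trace, e, Matrix.trace_add, Matrix.trace_sub, Matrix.trace_sub, Matrix.trace_one,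
    Matrix.trace_conjTranspose, Complex.add_re, Complex.sub_re, Complex.sub_re, Complex.star_def,
    Complex.conj_re, Fintype.card_fin, Complex.natCast_re]
  ring

/-- On the kicked configuration `P • U₀` the crux's link metric collapses to the time-zero slice:
`Σ_e √fro (ρ(U e) - ρ((P • U₀) e)) = Σ_e [e ∈ slice] √fro (ρ P_e - 1)` (`ρ(U e)` is unitary). [folklore] -/
theorem oneStep_kick_sum {L : ℕ} [NeZero L] {G : Type*} [Group G] [TopologicalSpace G]
    (r : LatticeRep G) (U : GaugeConfig 4 L G) :
    ∑ e : Edge 4 L, Real.sqrt (∑ a, ∑ b, ‖(r.ρ (U e) -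
        r.ρ (if e.1 0 = 0 ∧ e.2 ≠ 0 then plaquetteHolonomy U e.1 0 e.2 * U e else U e)) a b‖ ^ 2) =
      ∑ e : Edge 4 L, (if e.1 0 = 0 ∧ e.2 ≠ 0 then
        Real.sqrt (∑ a, ∑ b, ‖(r.ρ (plaquetteHolonomy U e.1 0 e.2) - 1) a b‖ ^ 2) else 0) := by
  refine Finset.sum_congr rfl fun e _ => ?_
  split_ifs with h
  · have hfac : r.ρ (U e) - r.ρ (plaquetteHolonomy U e.1 0 e.2 * U e) =
        (1 - r.ρ (plaquetteHolonomy U e.1 0 e.2)) * r.ρ (U e) := by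
      rw [map_mul, Matrix.sub_mul, Matrix.one_mul]
    rw [hfac, fro_mul_of_mem_unitaryGroup _ (r.mem_unitary (U e))]
    congr 1
    refine Finset.sum_congr rfl fun a _ => Finset.sum_congr rfl fun b _ => ?_
    rw [Matrix.sub_apply, Matrix.sub_apply, norm_sub_rev]
  · simp

/-- **Pointwise one-step bound through the Lipschitz constant** `K` of a gauge-invariant `f` of the
time-zero spatial links: `(f U - f (τ₁ U))² ≤ K² (Σ_{e ∈ slice} √fro (ρ P_e - 1))²`. [folklore] -/
theorem oneStep_sq_le {G : Type} [Group G] [TopologicalSpace G] (r : LatticeRep G) {S : ℕ}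
    (f : GaugeConfig 4 (2 * S + 1) G → ℝ) (hf₁ : IsGaugeInvariant f)
    (hf₂ : ∀ U V : GaugeConfig 4 (2 * S + 1) G,
      (∀ e : Edge 4 (2 * S + 1), e.1 0 = 0 → e.2 ≠ 0 → U e = V e) → f U = f V)
    {K : ℝ} (hK : ∀ U V : GaugeConfig 4 (2 * S + 1) G,
      |f U - f V| ≤ K * ∑ e, Real.sqrt (∑ a, ∑ b, ‖(r.ρ (U e) - r.ρ (V e)) a b‖ ^ 2))
    (U : GaugeConfig 4 (2 * S + 1) G) :
    (f U - f (fun e => U (e.1 + Pi.single 0 ((1 : ℕ) : ZMod (2 * S + 1)), e.2))) ^ 2 ≤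
      K ^ 2 * (∑ e : Edge 4 (2 * S + 1), (if e.1 0 = 0 ∧ e.2 ≠ 0 then
        Real.sqrt (∑ a, ∑ b, ‖(r.ρ (plaquetteHolonomy U e.1 0 e.2) - 1) a b‖ ^ 2) else 0)) ^ 2 := by
  rw [oneStep_transport f hf₁ hf₂ U]
  have h := hK U (fun e => if e.1 0 = 0 ∧ e.2 ≠ 0 then plaquetteHolonomy U e.1 0 e.2 * U e else U e)
  beta_reduce at h
  rw [oneStep_kick_sum r U] at h
  rw [← sq_abs, ← mul_pow]
  exact pow_le_pow_left₀ (abs_nonneg _) h 2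

section SliceSums

variable {L : ℕ} [NeZero L]

/-- A function of the direction summed over the time-zero spatial edges is `#{x : x₀ = 0} · Σ_{j=1,2,3} h j`. [folklore] -/
theorem sum_slice_eq (h : Fin 4 → ℝ) :
    ∑ e : Edge 4 L, (if e.1 0 = 0 ∧ e.2 ≠ 0 then h e.2 else 0) =
      (∑ x : Site 4 L, if x 0 = 0 then (1 : ℝ) else 0) * ∑ j : Fin 3, h j.succ := by
  rw [Fintype.sum_prod_type, Finset.sum_mul]
  refine Finset.sum_congr rfl fun x _ => ?_
  by_cases hx : x 0 = 0
  · simp only [hx, true_and, if_true, one_mul]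
    rw [Fin.sum_univ_succ]
    simp [Fin.succ_ne_zero]
  · simp [hx]

/-- The time-zero slice of the torus `(ℤ/L)⁴` has `L³` sites. [folklore] -/
theorem sum_site_slice : ∑ x : Site 4 L, (if x 0 = 0 then (1 : ℝ) else 0) = (L : ℝ) ^ 3 := by
  rw [← Fintype.sum_equiv (Fin.consEquiv fun _ : Fin 4 => ZMod L)
    (fun p => if p.1 = 0 then (1 : ℝ) else 0) _ (fun p => by simp)]
  rw [Fintype.sum_prod_type, Finset.sum_comm]
  simp [Finset.sum_ite_eq', ZMod.card]

/-- The time-zero slice of the torus `(ℤ/L)⁴` has `3L³` spatial edges. [folklore] -/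
theorem sum_edge_slice :
    ∑ e : Edge 4 L, (if e.1 0 = 0 ∧ e.2 ≠ 0 then (1 : ℝ) else 0) = 3 * (L : ℝ) ^ 3 := by
  rw [sum_slice_eq (L := L) (fun _ => (1 : ℝ)), sum_site_slice]
  simp
  ring

/-- Cauchy–Schwarz across the slice: `(Σ_{e ∈ slice} √fro_e)² ≤ #slice · Σ_{e ∈ slice} fro_e`. [folklore] -/
theorem oneStep_kick_sq_le {N : ℕ} (F : Edge 4 L → Matrix (Fin N) (Fin N) ℂ) :
    (∑ e : Edge 4 L, (if e.1 0 = 0 ∧ e.2 ≠ 0 then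
        Real.sqrt (∑ a, ∑ b, ‖F e a b‖ ^ 2) else 0)) ^ 2 ≤
      (∑ e : Edge 4 L, (if e.1 0 = 0 ∧ e.2 ≠ 0 then (1 : ℝ) else 0)) *
        ∑ e : Edge 4 L, (if e.1 0 = 0 ∧ e.2 ≠ 0 then (∑ a, ∑ b, ‖F e a b‖ ^ 2) else 0) := by
  rw [← Finset.sum_filter, ← Finset.sum_filter, ← Finset.sum_filter, Finset.sum_const, nsmul_eq_mul,
    mul_one]
  refine sq_sum_le_card_mul_sum_sq.trans (le_of_eq ?_)
  congr 1
  exact Finset.sum_congr rfl fun e _ => Real.sq_sqrt (by positivity)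

end SliceSums

/-- Each kick size `U ↦ fro (ρ U_{p_{0j}(x)} - 1)` is continuous. [folklore] -/
theorem continuous_fro_kick {L : ℕ} {G : Type*} [Group G] [TopologicalSpace G]
    [IsTopologicalGroup G] (r : LatticeRep G) (x : Site 4 L) (j : Fin 4) :
    Continuous fun U : GaugeConfig 4 L G =>
      ∑ a, ∑ b, ‖(r.ρ (plaquetteHolonomy U x 0 j) - 1) a b‖ ^ 2 := by
  have hP : Continuous fun U : GaugeConfig 4 L G => plaquetteHolonomy U x 0 j := by
    unfold plaquetteHolonomy; fun_prop
  have h1 : Continuous fun U : GaugeConfig 4 L G => r.ρ (plaquetteHolonomy U x 0 j) - 1 :=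
    (r.continuous.comp hP).sub continuous_const
  exact continuous_finsetSum _ fun a _ =>
    continuous_finsetSum _ fun b _ => (continuous_norm.comp (h1.matrix_elem a b)).pow 2

/-- The slice kick size `U ↦ Σ_{e ∈ slice} √fro (ρ P_e(U) - 1)` is continuous. [folklore] -/
theorem oneStep_continuous_kick {L : ℕ} [NeZero L] {G : Type*} [Group G] [TopologicalSpace G]
    [IsTopologicalGroup G] (r : LatticeRep G) :
    Continuous fun U : GaugeConfig 4 L G => ∑ e : Edge 4 L, (if e.1 0 = 0 ∧ e.2 ≠ 0 then
      Real.sqrt (∑ a, ∑ b, ‖(r.ρ (plaquetteHolonomy U e.1 0 e.2) - 1) a b‖ ^ 2) else 0) := by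
  refine continuous_finsetSum _ fun e _ => ?_
  split_ifs
  exacts [Real.continuous_sqrt.comp (continuous_fro_kick r e.1 e.2), continuous_const]

section Kicks

variable {L : ℕ} [NeZero L] {G : Type*} [Group G] [TopologicalSpace G] [IsTopologicalGroup G]
  [CompactSpace G] [MeasurableSpace G] [BorelSpace G]

/-- A continuous real function of the configuration is integrable for Wilson's measure. [folklore] -/
theorem integrable_wilson_of_continuous (r : LatticeRep G) (β : ℝ) {φ : GaugeConfig 4 L G → ℝ}
    (hφ : Continuous φ) : Integrable φ (wilsonMeasure r.ρ β) := by
  haveI : SecondCountableTopology G :=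
    (r.continuous.isClosedEmbedding r.injective).isEmbedding.secondCountableTopology
  haveI := isProbabilityMeasure_wilsonMeasure (d := 4) (L := L) r.ρ r.continuous β
  obtain ⟨C, hC⟩ := rpHankel_bounded hφ
  exact Integrable.of_bound hφ.measurable.aestronglyMeasurable C
    (ae_of_all _ fun U => by rw [Real.norm_eq_abs]; exact hC U)

/-- Translation invariance of one-plaquette Wilson expectations (`wilsonMeasure_map_torusConfigShift`):
`E_μ g(U_{p_{ij}(x)}) = E_μ g(U_{p_{ij}(0)})` for every `g : G → ℝ`. [folklore] -/
theorem integral_plaquette_eq_origin {N : ℕ} (ρ : G →* Matrix (Fin N) (Fin N) ℂ) (β : ℝ)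
    (g : G → ℝ) (x : Site 4 L) (i j : Fin 4) :
    ∫ U : GaugeConfig 4 L G, g (plaquetteHolonomy U x i j) ∂(wilsonMeasure ρ β) =
      ∫ U : GaugeConfig 4 L G, g (plaquetteHolonomy U (0 : Site 4 L) i j) ∂(wilsonMeasure ρ β) := by
  have h : ∀ U : GaugeConfig 4 L G,
      plaquetteHolonomy U x i j = plaquetteHolonomy (torusConfigShift (-x) U) (0 : Site 4 L) i j :=
    fun U => by rw [plaquetteHolonomy_torusConfigShift, zero_sub, neg_neg]
  simp_rw [h]
  rw [← integral_map_equiv (torusConfigShift (-x))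
    (fun V : GaugeConfig 4 L G => g (plaquetteHolonomy V (0 : Site 4 L) i j)),
    wilsonMeasure_map_torusConfigShift]

/-- **Mean-square Frobenius size of one temporal-plaquette kick** = twice the mean plaquette action
at the origin: `E_μ fro (ρ U_{p_{0j}(x)} - 1) = 2 E_μ (N - Re tr ρ U_{p_{0j}(0)})`. [folklore] -/
theorem integral_fro_kick (r : LatticeRep G) (β : ℝ) (x : Site 4 L) (j : Fin 4) :
    ∫ U : GaugeConfig 4 L G, (∑ a, ∑ b, ‖(r.ρ (plaquetteHolonomy U x 0 j) - 1) a b‖ ^ 2)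
        ∂(wilsonMeasure r.ρ β) =
      2 * ∫ U : GaugeConfig 4 L G, ((r.N : ℝ) -
        (r.ρ (plaquetteHolonomy U (0 : Site 4 L) 0 j)).trace.re) ∂(wilsonMeasure r.ρ β) := by
  have h : ∀ P : G, (∑ a, ∑ b, ‖(r.ρ P - 1) a b‖ ^ 2) = 2 * ((r.N : ℝ) - (r.ρ P).trace.re) :=
    fun P => by rw [fro_sub_one_eq (r.mem_unitary P)]; ring
  simp_rw [h]
  rw [integral_const_mul, integral_plaquette_eq_origin r.ρ β (fun P => (r.N : ℝ) - (r.ρ P).trace.re)]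

/-- **Mean-square size of the whole kick field seen through the Lipschitz seminorm**:
`E_μ (Σ_{e ∈ slice} ‖ρ P_e - 1‖_F)² ≤ 3L³ · Σ_{e ∈ slice} E_μ ‖ρ P_e - 1‖_F² = 6 L⁶ · plaq`. [folklore] -/
theorem integral_kick_sq_le_plaq (r : LatticeRep G) (β : ℝ) :
    ∫ U : GaugeConfig 4 L G, (∑ e : Edge 4 L, (if e.1 0 = 0 ∧ e.2 ≠ 0 then
        Real.sqrt (∑ a, ∑ b, ‖(r.ρ (plaquetteHolonomy U e.1 0 e.2) - 1) a b‖ ^ 2) else 0)) ^ 2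
        ∂(wilsonMeasure r.ρ β) ≤
      6 * (L : ℝ) ^ 6 * ∑ j : Fin 3, ∫ U : GaugeConfig 4 L G, ((r.N : ℝ) -
        (r.ρ (plaquetteHolonomy U (0 : Site 4 L) 0 j.succ)).trace.re) ∂(wilsonMeasure r.ρ β) := by
  haveI := isProbabilityMeasure_wilsonMeasure (d := 4) (L := L) r.ρ r.continuous β
  set μ := wilsonMeasure (d := 4) (L := L) r.ρ β with hμ
  set F : Edge 4 L → GaugeConfig 4 L G → ℝ := fun e U =>
    if e.1 0 = 0 ∧ e.2 ≠ 0 then (∑ a, ∑ b, ‖(r.ρ (plaquetteHolonomy U e.1 0 e.2) - 1) a b‖ ^ 2)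
    else 0 with hF
  have hFi : ∀ e, Integrable (F e) μ := fun e => by
    by_cases he : e.1 0 = 0 ∧ e.2 ≠ 0
    · simp only [hF, if_pos he]
      exact integrable_wilson_of_continuous r β (continuous_fro_kick r e.1 e.2)
    · simp only [hF, if_neg he]
      exact integrable_const _
  have hFint : ∀ e, ∫ U, F e U ∂μ = if e.1 0 = 0 ∧ e.2 ≠ 0 then
      2 * ∫ U : GaugeConfig 4 L G, ((r.N : ℝ) -
        (r.ρ (plaquetteHolonomy U (0 : Site 4 L) 0 e.2)).trace.re) ∂μ else 0 := fun e => by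
    by_cases he : e.1 0 = 0 ∧ e.2 ≠ 0
    · simp only [hF, if_pos he]
      exact integral_fro_kick r β e.1 e.2
    · simp only [hF, if_neg he, integral_zero]
  have hcs : ∀ U : GaugeConfig 4 L G,
      (∑ e : Edge 4 L, (if e.1 0 = 0 ∧ e.2 ≠ 0 then
        Real.sqrt (∑ a, ∑ b, ‖(r.ρ (plaquetteHolonomy U e.1 0 e.2) - 1) a b‖ ^ 2) else 0)) ^ 2 ≤
      (3 * (L : ℝ) ^ 3) * ∑ e : Edge 4 L, F e U := fun U => by
    have h := oneStep_kick_sq_le (L := L) (fun e => r.ρ (plaquetteHolonomy U e.1 0 e.2) - 1)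
    beta_reduce at h
    rw [sum_edge_slice] at h
    exact h
  have hint_lhs : Integrable (fun U : GaugeConfig 4 L G => (∑ e : Edge 4 L,
      (if e.1 0 = 0 ∧ e.2 ≠ 0 then
        Real.sqrt (∑ a, ∑ b, ‖(r.ρ (plaquetteHolonomy U e.1 0 e.2) - 1) a b‖ ^ 2) else 0)) ^ 2) μ :=
    integrable_wilson_of_continuous r β ((oneStep_continuous_kick (L := L) r).pow 2)
  have hint_rhs : Integrable (fun U : GaugeConfig 4 L G =>
      (3 * (L : ℝ) ^ 3) * ∑ e : Edge 4 L, F e U) μ :=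
    (integrable_finsetSum _ fun e _ => hFi e).const_mul _
  calc ∫ U, (∑ e : Edge 4 L, (if e.1 0 = 0 ∧ e.2 ≠ 0 then
          Real.sqrt (∑ a, ∑ b, ‖(r.ρ (plaquetteHolonomy U e.1 0 e.2) - 1) a b‖ ^ 2) else 0)) ^ 2 ∂μ
      ≤ ∫ U, (3 * (L : ℝ) ^ 3) * ∑ e : Edge 4 L, F e U ∂μ := integral_mono hint_lhs hint_rhs hcs
    _ = (3 * (L : ℝ) ^ 3) * ∑ e : Edge 4 L, ∫ U, F e U ∂μ := by
        rw [integral_const_mul, integral_finsetSum _ fun e _ => hFi e]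
    _ = (3 * (L : ℝ) ^ 3) * ((L : ℝ) ^ 3 * ∑ j : Fin 3, 2 * ∫ U : GaugeConfig 4 L G, ((r.N : ℝ) -
          (r.ρ (plaquetteHolonomy U (0 : Site 4 L) 0 j.succ)).trace.re) ∂μ) := by
        simp_rw [hFint]
        rw [sum_slice_eq (L := L) (fun j => 2 * ∫ U : GaugeConfig 4 L G, ((r.N : ℝ) -
          (r.ρ (plaquetteHolonomy U (0 : Site 4 L) 0 j)).trace.re) ∂μ), sum_site_slice]
    _ = 6 * (L : ℝ) ^ 6 * ∑ j : Fin 3, ∫ U : GaugeConfig 4 L G, ((r.N : ℝ) -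
          (r.ρ (plaquetteHolonomy U (0 : Site 4 L) 0 j.succ)).trace.re) ∂μ := by
        rw [← Finset.mul_sum]; ring

end Kicks

/-! ### The one-step variation in the skeleton's `let` conventions -/

/-- **Integrated one-step bound through the Lipschitz constant** `K` (same `let` conventions as the
skeleton): `E_μ (f - f ∘ τ₁)² ≤ K² · E_μ (Σ_{e ∈ slice} ‖ρ P_e - 1‖_F)²`, `P_e = plaquetteHolonomy U e.1 0 e.2`. [folklore] -/
theorem oneStep_le_lipschitz
    (G : Type) [Group G] [TopologicalSpace G] [IsTopologicalGroup G] [CompactSpace G]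
    [MeasurableSpace G] [BorelSpace G] (r : LatticeRep G) (β : ℝ) (S : ℕ) :
    let μ := wilsonMeasure (d := 4) (L := 2 * S + 1) r.ρ β
    let fro : Matrix (Fin r.N) (Fin r.N) ℂ → ℝ := fun M => ∑ a, ∑ b, ‖M a b‖ ^ 2
    let τ : ℕ → GaugeConfig 4 (2 * S + 1) G → GaugeConfig 4 (2 * S + 1) G :=
      fun t U e => U (e.1 + Pi.single 0 ((t : ℕ) : ZMod (2 * S + 1)), e.2)
    ∀ f : GaugeConfig 4 (2 * S + 1) G → ℝ, IsGaugeInvariant f →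
      (∀ U V : GaugeConfig 4 (2 * S + 1) G,
        (∀ e : Edge 4 (2 * S + 1), e.1 0 = 0 → e.2 ≠ 0 → U e = V e) → f U = f V) →
      ∀ K : ℝ, (∀ U V : GaugeConfig 4 (2 * S + 1) G,
        |f U - f V| ≤ K * ∑ e, Real.sqrt (fro (r.ρ (U e) - r.ρ (V e)))) →
      ∫ U, (f U - f (τ 1 U)) ^ 2 ∂μ ≤
        K ^ 2 * ∫ U, (∑ e : Edge 4 (2 * S + 1), (if e.1 0 = 0 ∧ e.2 ≠ 0 then
          Real.sqrt (fro (r.ρ (plaquetteHolonomy U e.1 0 e.2) - 1)) else 0)) ^ 2 ∂μ := by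
  intro μ fro τ f hf₁ hf₂ K hK
  rw [← integral_const_mul]
  exact integral_mono_of_nonneg (ae_of_all _ fun U => sq_nonneg _)
    ((integrable_wilson_of_continuous r β ((oneStep_continuous_kick (L := 2 * S + 1) r).pow 2)).const_mul _)
    (ae_of_all _ fun U => oneStep_sq_le r f hf₁ hf₂ hK U)

/-- **Lossy one-step bound through the plaquette action** (same `let` conventions as the skeleton):
`c(f) = E_μ (f - f ∘ τ₁)² ≤ 6 K² (2S+1)⁶ · plaq` for a gauge-invariant link-Lipschitz `f` (constant `K`)
of the time-zero spatial links — the complete rigorous chain transport identity → Lipschitz →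
Cauchy–Schwarz → kick size `2 · plaq` per site; NOT the withdrawn stub (C) (module docstring). [folklore] -/
theorem oneStep_le_lipschitz_plaq
    (G : Type) [Group G] [TopologicalSpace G] [IsTopologicalGroup G] [CompactSpace G]
    [MeasurableSpace G] [BorelSpace G] (r : LatticeRep G) (β : ℝ) (S : ℕ) :
    let μ := wilsonMeasure (d := 4) (L := 2 * S + 1) r.ρ β
    let fro : Matrix (Fin r.N) (Fin r.N) ℂ → ℝ := fun M => ∑ a, ∑ b, ‖M a b‖ ^ 2
    let τ : ℕ → GaugeConfig 4 (2 * S + 1) G → GaugeConfig 4 (2 * S + 1) G :=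
      fun t U e => U (e.1 + Pi.single 0 ((t : ℕ) : ZMod (2 * S + 1)), e.2)
    let plaq : ℝ := ∑ j : Fin 3, ∫ U, ((r.N : ℝ) -
      (r.ρ (plaquetteHolonomy U (0 : Site 4 (2 * S + 1)) 0 j.succ)).trace.re) ∂μ
    ∀ f : GaugeConfig 4 (2 * S + 1) G → ℝ, IsGaugeInvariant f →
      (∀ U V : GaugeConfig 4 (2 * S + 1) G,
        (∀ e : Edge 4 (2 * S + 1), e.1 0 = 0 → e.2 ≠ 0 → U e = V e) → f U = f V) →
      ∀ K : ℝ, (∀ U V : GaugeConfig 4 (2 * S + 1) G,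
        |f U - f V| ≤ K * ∑ e, Real.sqrt (fro (r.ρ (U e) - r.ρ (V e)))) →
      ∫ U, (f U - f (τ 1 U)) ^ 2 ∂μ ≤ 6 * K ^ 2 * ((2 * S + 1 : ℕ) : ℝ) ^ 6 * plaq := by
  intro μ fro τ plaq f hf₁ hf₂ K hK
  have h1 := oneStep_le_lipschitz G r β S f hf₁ hf₂ K hK
  have h2 := integral_kick_sq_le_plaq (L := 2 * S + 1) r β
  calc ∫ U, (f U - f (τ 1 U)) ^ 2 ∂μ
      ≤ K ^ 2 * ∫ U, (∑ e : Edge 4 (2 * S + 1), (if e.1 0 = 0 ∧ e.2 ≠ 0 then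
          Real.sqrt (fro (r.ρ (plaquetteHolonomy U e.1 0 e.2) - 1)) else 0)) ^ 2 ∂μ := h1
    _ ≤ K ^ 2 * (6 * ((2 * S + 1 : ℕ) : ℝ) ^ 6 * plaq) := mul_le_mul_of_nonneg_left h2 (sq_nonneg K)
    _ = 6 * K ^ 2 * ((2 * S + 1 : ℕ) : ℝ) ^ 6 * plaq := by ring

end Summit.QuantumFields.YangMills.Theorems.BrascampLiebVacuum

end
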